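import Summits.QuantumFields.QCD.Theses.WilsonMobilityGap
import Summits.QuantumFields.QCD.Theorems.WilsonMobilityGapMobilityGapWilsonPointwiseCoercive
import Summits.QuantumFields.QCD.Theorems.WilsonMobilityGapMobilityGapSketchDefs

/-!
# Crux `MobilityGap` (stmt-QuantumFields-9150) — ideator 4, round 2: first lemmas for the card
`heavy-margin-block-fm` ("renormalise first, then one fractional-moment step on the block graph,
on a trajectory kept a mass MARGIN `K` above the running-mass zero").

Contents (folder sketch; `lean check` target):
* §1 `marginReg` — the margin trajectory as a `QCDRegularisation` (mcrit := x₀ + K·r·a, i.e. a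
  margin `K/n₀`, `n₀ = 1/(r a_k)`, above the flow's running-mass zero `x₀ k`), and its bare masses.
* §2 `closure_achievable` — the one-step closure constant
  `c_d·((1-ρ)·e^{-sθK} + ρ^{1-s}·C_ap)` is `< 1/2` for all `K ≥ K₀`, `ρ ≤ ρ₀`: the crux's two free
  choices (offset margin `K`; rate `r`, hence `g(1/r)`, hence bad-block density `ρ`) close the step.
  PROVED.
* §3 `oneStep_decay` — deterministic skeleton of the FM iteration on a bounded-degree connected
  graph: a one-step subharmonic bound with `d·γ < 1` forces geometric decay in graph distance.
  PROVED (induction on `dist`).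
* §4 `crossingMass_eq_neg_wilsonForm` — the exact identity behind the (iv) discussion: at a real-mode
  crossing `D_W(U,m₀,1)ψ = 0` the crossing mass is minus the Wilson (covariant-kinetic) form of the
  mode, `m₀·Σ‖ψ_i‖² = -Re⟨ψ, D_W(U,0,1)ψ⟩ ≤ 0`.  PROVED from the landed `re_form_wilsonDirac_mass`,
  `re_form_wilsonDirac_zero_nonneg` (p123829).
-/

noncomputable section

namespace Summit.QuantumFields.QCD.Cruxes.MobilityGap.Ideator4

open scoped BigOperators Topology
open MeasureTheory Filter Set Matrix
open Literature.MathematicalPhysics.QuantumFieldTheory Literature.MathematicalPhysics.QuantumLattice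
  Literature.Probability.LatticeModels
open Summit.QuantumFields.QCD.Theorems.MobilityGapPositiveMass

/-! ### §1 The margin trajectory -/

variable {Nf : ℕ}

/-- The MARGIN regularisation: same data `(a, β, L, Z_m)` as `reg`, critical mass parked a margin
`K·r·a_k = K/n₀` (`n₀ = 1/(r a_k)` the flow scale) ABOVE the running-mass zero `x₀ k` of the UV block
flow.  Legal for stmt-9150 rev 5 (no `IsChiralAtZero` clause): the realised RGI masses are
`M_f = M₀ + κ m_f` with `M₀ ≍ K r` in `Λ`-units. -/
def marginReg (reg : QCDRegularisation Nf) (x₀ : ℕ → ℝ) (K r : ℝ) : QCDRegularisation Nf :=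
  { reg with mcrit := fun k => x₀ k + K * r * reg.a k }

@[simp] theorem marginReg_mcrit (reg : QCDRegularisation Nf) (x₀ : ℕ → ℝ) (K r : ℝ) (k : ℕ) :
    (marginReg reg x₀ K r).mcrit k = x₀ k + K * r * reg.a k := rfl

@[simp] theorem marginReg_a (reg : QCDRegularisation Nf) (x₀ : ℕ → ℝ) (K r : ℝ) :
    (marginReg reg x₀ K r).a = reg.a := rfl

/-- Bare mass of flavour `f` on the margin trajectory: `x₀ k + K r a_k + a_k m_f / Z_m(k)` — every
flavour of every tuple sits at least the margin `K r a_k` above `x₀ k` (and within `o(a_k)` of it,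
since `Z_m(k) → ∞` under `HasMassScaling`). -/
theorem marginReg_bare (reg : QCDRegularisation Nf) (x₀ : ℕ → ℝ) (K r : ℝ) (m : Fin Nf → ℝ)
    (f : Fin Nf) (k : ℕ) :
    (marginReg reg x₀ K r).mcrit k + (marginReg reg x₀ K r).a k * m f / (marginReg reg x₀ K r).Zm k =
      x₀ k + K * r * reg.a k + reg.a k * m f / reg.Zm k := rfl

/-- Clause (i) on the margin trajectory is bookkeeping: if the running-mass zero stays above `-1`
eventually (it tends to `0⁻`) then so does every positive tuple's bare mass. -/
theorem marginReg_clauseI (reg : QCDRegularisation Nf) (x₀ : ℕ → ℝ) {K r : ℝ} (hK : 0 ≤ K) (hr : 0 ≤ r)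
    (hx₀ : ∀ᶠ k in atTop, -1 < x₀ k) (m : Fin Nf → ℝ) (hm : ∀ f, 0 < m f) (f : Fin Nf) :
    ∀ᶠ k in atTop, -1 < (marginReg reg x₀ K r).mcrit k +
      (marginReg reg x₀ K r).a k * m f / (marginReg reg x₀ K r).Zm k := by
  filter_upwards [hx₀] with k hk
  rw [marginReg_bare]
  have h1 : 0 ≤ K * r * reg.a k := mul_nonneg (mul_nonneg hK hr) (reg.a_pos k).le
  have h2 : 0 < reg.a k * m f / reg.Zm k := div_pos (mul_pos (reg.a_pos k) (hm f)) (reg.Zm_pos k)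
  linarith

/-! ### §2 The one-step closure constant is achievable by the crux's free choices -/

/-- **Closure arithmetic.**  For `0 < s < 1`, `θ > 0`, block coordination constant `c_d > 0` and
a-priori constant `C_ap ≥ 0` there are `K₀, ρ₀ > 0` such that for every margin `K ≥ K₀` and every
conditional bad-block density `ρ ∈ [0, ρ₀]` the one-step factor is `< 1/2`:
`c_d · ((1 - ρ)·exp(-(s θ K)) + ρ^{1-s}·C_ap) < 1/2`. -/
theorem closure_achievable {s θ c_d C_ap : ℝ} (hs : 0 < s) (hs1 : s < 1) (hθ : 0 < θ)
    (hcd : 0 < c_d) (hC : 0 ≤ C_ap) :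
    ∃ K₀ ρ₀ : ℝ, 0 < K₀ ∧ 0 < ρ₀ ∧ ∀ K ρ : ℝ, K₀ ≤ K → 0 ≤ ρ → ρ ≤ ρ₀ →
      c_d * ((1 - ρ) * Real.exp (-(s * θ * K)) + ρ ^ (1 - s) * C_ap) < 1 / 2 := by
  -- choose K₀ with c_d e^{-sθK₀} ≤ 1/8 and ρ₀ with c_d ρ₀^{1-s} C_ap ≤ 1/8
  have hsθ : 0 < s * θ := mul_pos hs hθ
  obtain ⟨K₀, hK₀pos, hK₀⟩ : ∃ K₀ : ℝ, 0 < K₀ ∧ c_d * Real.exp (-(s * θ * K₀)) ≤ 1 / 8 := by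
    have ht : Tendsto (fun K : ℝ => c_d * Real.exp (-(s * θ * K))) atTop (𝓝 (c_d * 0)) := by
      refine tendsto_const_nhds.mul ?_
      have : Tendsto (fun K : ℝ => s * θ * K) atTop atTop := tendsto_id.const_mul_atTop hsθ
      exact Real.tendsto_exp_neg_atTop_nhds_zero.comp this
    rw [mul_zero] at ht
    obtain ⟨K₀, hK₀⟩ := ((ht.eventually (eventually_le_nhds (by norm_num : (0:ℝ) < 1/8))).and
      (eventually_gt_atTop 0)).exists
    exact ⟨K₀, hK₀.2, hK₀.1⟩
  have h1s : 0 < 1 - s := by linarith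
  -- ρ₀ := (1/8 / (c_d (C_ap + 1)))^{1/(1-s)} ∧ ρ₀ ≤ 1
  set A : ℝ := 1 / 8 / (c_d * (C_ap + 1)) with hA
  have hApos : 0 < A := by positivity
  set ρ₀ : ℝ := min 1 (A ^ (1 / (1 - s))) with hρ₀
  have hρ₀pos : 0 < ρ₀ := lt_min one_pos (Real.rpow_pos_of_pos hApos _)
  refine ⟨K₀, ρ₀, hK₀pos, hρ₀pos, fun K ρ hK hρ hρle => ?_⟩
  have hρ1 : ρ ≤ 1 := hρle.trans (min_le_left _ _)
  -- first summand
  have e1 : c_d * ((1 - ρ) * Real.exp (-(s * θ * K))) ≤ 1 / 8 := by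
    have hmono : Real.exp (-(s * θ * K)) ≤ Real.exp (-(s * θ * K₀)) := by
      rw [Real.exp_le_exp]; nlinarith
    calc c_d * ((1 - ρ) * Real.exp (-(s * θ * K)))
        ≤ c_d * (1 * Real.exp (-(s * θ * K₀))) := by
          apply mul_le_mul_of_nonneg_left _ hcd.le
          exact mul_le_mul (by linarith) hmono (Real.exp_pos _).le zero_le_one
      _ = c_d * Real.exp (-(s * θ * K₀)) := by ring
      _ ≤ 1 / 8 := hK₀
  -- second summand: ρ^{1-s} ≤ ρ₀^{1-s} ≤ A
  have e2 : c_d * (ρ ^ (1 - s) * C_ap) ≤ 1 / 8 := by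
    have hρpow : ρ ^ (1 - s) ≤ A := by
      have h' : ρ ^ (1 - s) ≤ (A ^ (1 / (1 - s))) ^ (1 - s) :=
        Real.rpow_le_rpow hρ (hρle.trans (min_le_right _ _)) h1s.le
      rwa [← Real.rpow_mul hApos.le, one_div_mul_cancel h1s.ne', Real.rpow_one] at h'
    calc c_d * (ρ ^ (1 - s) * C_ap) ≤ c_d * (A * (C_ap + 1)) := by
          apply mul_le_mul_of_nonneg_left _ hcd.le
          exact mul_le_mul hρpow (by linarith) hC hApos.le
      _ = 1 / 8 := by rw [hA]; field_simp
  calc c_d * ((1 - ρ) * Real.exp (-(s * θ * K)) + ρ ^ (1 - s) * C_ap)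
      = c_d * ((1 - ρ) * Real.exp (-(s * θ * K))) + c_d * (ρ ^ (1 - s) * C_ap) := by ring
    _ ≤ 1 / 8 + 1 / 8 := add_le_add e1 e2
    _ < 1 / 2 := by norm_num

/-! ### §3 Deterministic skeleton of the fractional-moment iteration on the block graph -/

/-- **One-step bound ⇒ geometric decay** (the FM iteration, disorder already integrated out):
on a connected graph of maximal degree `≤ d`, a bounded nonnegative kernel `M ≤ B` obeying the
one-step subharmonic bound `M x y ≤ γ Σ_{z ∼ x} M z y` off the diagonal, with `d·γ < 1`, decays like
`(dγ)^{dist x y}`.  In the card, vertices are `n₀`-blocks, `M B B' = E[|G_eff(B,B')|^s]`, and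
`γ` is the closure constant of §2. -/
theorem oneStep_decay {V : Type*} [Fintype V] [DecidableEq V] (G : SimpleGraph V)
    [DecidableRel G.Adj] (hconn : G.Connected) {d : ℕ} (hdeg : ∀ x, G.degree x ≤ d)
    (M : V → V → ℝ) {B γ : ℝ} (hB : 0 ≤ B) (hγ : 0 ≤ γ) (hM0 : ∀ x y, 0 ≤ M x y)
    (hMB : ∀ x y, M x y ≤ B)
    (hstep : ∀ x y, x ≠ y → M x y ≤ γ * ∑ z ∈ G.neighborFinset x, M z y)
    (hdγ : (d : ℝ) * γ < 1) :
    ∀ x y, M x y ≤ B * ((d : ℝ) * γ) ^ G.dist x y := by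
  -- claim: pairs at distance ≥ n are bounded by B (dγ)^n, by induction on n
  have hdγ0 : 0 ≤ (d : ℝ) * γ := mul_nonneg (Nat.cast_nonneg d) hγ
  have claim : ∀ n : ℕ, ∀ x y, n ≤ G.dist x y → M x y ≤ B * ((d : ℝ) * γ) ^ n := by
    intro n
    induction n with
    | zero => intro x y _; simpa using hMB x y
    | succ n ih =>
      intro x y hn
      have hxy : x ≠ y := by
        rintro rfl
        simp [SimpleGraph.dist_self] at hn
      have hz : ∀ z ∈ G.neighborFinset x, M z y ≤ B * ((d : ℝ) * γ) ^ n := by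
        intro z hz
        rw [SimpleGraph.mem_neighborFinset] at hz
        apply ih
        have htri : G.dist x y ≤ G.dist x z + G.dist z y := hconn.dist_triangle
        have h1 : G.dist x z = 1 := SimpleGraph.dist_eq_one_iff_adj.mpr hz
        omega
      have hsum : ∑ z ∈ G.neighborFinset x, M z y ≤ (d : ℝ) * (B * ((d : ℝ) * γ) ^ n) := by
        calc ∑ z ∈ G.neighborFinset x, M z y
            ≤ ∑ _z ∈ G.neighborFinset x, B * ((d : ℝ) * γ) ^ n := Finset.sum_le_sum hz
          _ = (G.neighborFinset x).card • (B * ((d : ℝ) * γ) ^ n) := by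
              rw [Finset.sum_const]
          _ = (G.degree x : ℝ) * (B * ((d : ℝ) * γ) ^ n) := by
              rw [SimpleGraph.card_neighborFinset_eq_degree, nsmul_eq_mul]
          _ ≤ (d : ℝ) * (B * ((d : ℝ) * γ) ^ n) := by
              apply mul_le_mul_of_nonneg_right _ (by positivity)
              exact_mod_cast hdeg x
      calc M x y ≤ γ * ∑ z ∈ G.neighborFinset x, M z y := hstep x y hxy
        _ ≤ γ * ((d : ℝ) * (B * ((d : ℝ) * γ) ^ n)) := mul_le_mul_of_nonneg_left hsum hγ
        _ = B * ((d : ℝ) * γ) ^ (n + 1) := by ring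
  intro x y
  exact claim (G.dist x y) x y le_rfl

/-! ### §4 The crossing-mass identity (for the sign clause (iv)) -/

/-- **Crossing mass = minus the Wilson form of the crossing mode.**  If `ψ` is annihilated by
`D_W(U, m₀, 1)` (a real-mode crossing of `D_W(U,0,1)` at `λ = -m₀`, equivalently a zero mode of
`Γ₅ D_W(U,m₀,1)`), then `m₀ · Σ_i ‖ψ_i‖² = -Re⟨ψ, D_W(U,0,1) ψ⟩`. -/
theorem crossingMass_eq_neg_wilsonForm {L : ℕ} [NeZero L]
    (U : GaugeConfig 4 L (Matrix.specialUnitaryGroup (Fin 3) ℂ)) (m₀ : ℝ)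
    (ψ : TorusSite 4 L × Fin 3 × Fin 4 → ℂ)
    (hψ : wilsonDirac (fundamentalRep (Fin 3)) U m₀ 1 *ᵥ ψ = 0) :
    m₀ * ∑ i, ‖ψ i‖ ^ 2 = -(star ψ ⬝ᵥ (wilsonDirac (fundamentalRep (Fin 3)) U 0 1 *ᵥ ψ)).re := by
  have h := re_form_wilsonDirac_mass U m₀ ψ
  rw [hψ, dotProduct_zero, Complex.zero_re] at h
  linarith

/-- Hence every crossing mass is `≤ 0` (supercritical) and its size IS the covariant kinetic energy
of the mode: `|m₀|·Σ‖ψ_i‖² = Re⟨ψ, D_W(U,0,1)ψ⟩ ≥ 0` — an EARLY crosser (small `|m₀|`) is a mode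
with small Wilson form, i.e. an almost covariantly constant spinor field. -/
theorem crossingMass_nonpos {L : ℕ} [NeZero L]
    (U : GaugeConfig 4 L (Matrix.specialUnitaryGroup (Fin 3) ℂ)) (m₀ : ℝ)
    (ψ : TorusSite 4 L × Fin 3 × Fin 4 → ℂ)
    (hψ : wilsonDirac (fundamentalRep (Fin 3)) U m₀ 1 *ᵥ ψ = 0) :
    m₀ * ∑ i, ‖ψ i‖ ^ 2 ≤ 0 := by
  rw [crossingMass_eq_neg_wilsonForm U m₀ ψ hψ, neg_nonpos]
  exact re_form_wilsonDirac_zero_nonneg U ψ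

end Summit.QuantumFields.QCD.Cruxes.MobilityGap.Ideator4

end
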